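import Summits.ABC.IUTFork.Cor312PilotIdelesPrContentBound
import Summits.ABC.IUTFork.Cor312ProvK
import Literature.IUT.LogVolume.PacketLogShellVolumeGaloisDescent
import Summits.ABC.IUTFork.Conditional.AbcOfSHvolSplitHeight
import Literature.IUT.LogVolume.InitialThetaDataVolume
import Literature.IUT.LogVolume.TensorPacketSlotUnion
import Literature.IUT.LogVolume.DifferentOrdGaloisFibre
import Literature.IUT.LogVolume.DifferentConductorTowerThreeField
import Literature.IUT.HodgeTheaters.InitialThetaDataKGaloisProofs
import HarnessLib

/-!
# [IUTchIII] Cor. 3.12 at the `K`-level sharp setting: the SLOT TRANSPORT from the section `V̲` to every tuple of places of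
# `K` (hΘ on the line of record v6K/v7K, step (a) of the descent assembly), and the norms of realising Θ-ideles

PROOF-ONLY support file (D-0012; no definitions, no `Prop` facts) of the abc-iut cell (R2 S-chain team, seat abc-iut-s2-p7 gen 2,
TARGET #2 `hΘ` = the READ binder «`(settingPrVolSharp (pilotDataOfK T.D T.K) …).negLogTheta ≤ ↑T.negLogTheta`» of the LINE OF
RECORD `Conditional/AbcOfSGenuineKChosen.lean` (v6K) / `…KCanonical.lean` (v7K); split BY NAME with abc-iut-s2-p6 gen 2, who holds the
assembly `Cor312ThetaSideClosedK`). TAKES NO SIDE on [IUTchIII] Cor. 3.12.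

THE GAP THIS FILE CLOSES. abc-iut-s2-p7 gen 0's `Thm311.Real.negLogTheta_settingPrVolSharp_le_sum_content_hull` (p438921) bounds the
`K`-level `−|log(Θ)|` by the Dupuy–Hilado content closed form over ALL tuples `w⃗ ∈ 𝕍(K)_p^{i+2}`, under ONE hypothesis `hslot`: at every
tuple and every slot `a`, `ι_a(t_{Θ,i+1,w_a})·(R_{w⃗})^∼ ⊆ p^{m(w⃗)}·log_p(R_{w⃗}^×)`. abc-iut-S2's genuine number `ThetaVolumeInput.negLogTheta`
([IUTchIII] Cor. 3.12 read over the SECTION `V̲ ≅ V_mod`, [IUTchI] Def. 3.1 (e)) knows such containments only at the SECTION tuples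
`v̲⃗` and only for ITS OWN ideles (abc-iut-c312-3 `ThetaVolumeInput.exists_contentFamily`). Here (classical bookkeeping, [IUTchI] Rmk. 3.1.5
«`K` is Galois over `F_mod`»; Cassels–Fröhlich VII §1.1, Prop. 1.2 (ii)):

* §1 GENERIC packet algebra over two tuples of MLF-class fields `k, k' : I → Type` joined by ISOMETRIC `ℚ_p`-algebra isomorphisms
  `φ_a : k_a ≃ k'_a`: `factorAlgEquiv_iota` (`(⊗φ)(ι_a u) = ι_a(φ_a u)`), `image_factorAlgEquiv_iota_smul_normalizedPacket`,
  `image_factorAlgEquiv_zpow_smul_logPacket`, `iota_smul_normalizedPacket_eq_of_norm_eq_sameSlot` (same slot, same absolute value ⇒ same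
  translate of `(R_I)^∼` — a unit ratio, abc-iut-S8 `iota_smul_normalizedPacket_eq_of_norm_eq_one`), and
  **`iota_smul_normalizedPacket_subset_of_factorIso`**: `⋃_a ι_a(x_a)·(R_I)^∼ ⊆ p^m·log_p(R_I^×)` and `‖y‖ = ‖x_a‖` ⟹
  `ι_a(y)·(R'_I)^∼ ⊆ p^m·log_p(R'_I^×)` (transport along `⊗φ`, abc-iut-w5-d056 `image_normalizedPacket_factor` / `image_logPacket_factor`).
* §2 at the `K`-LEVEL PILOT DATUM `pilotDataOfK D K` (abc-iut-C-cert-3 p434046) of a collection of initial Θ-data `D`: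
  `mem_S_pilotDataOfK_iff_finBelow_mem`, `pilotDataOfK_jE_eq_algebraMap_jMod`,
  **`thetaPilot_pilotDataOfK_mul_logNorm_div_localDegree`** — `P_Θ,K(i,w)·log N(w)/n_w = P_Θ,mod(i,v)·log N(v)/n_v` for `w | v` (the
  normalised local height of `j_E ∈ F_mod` does not see the field: abc-iut-s2-p5 `ord_mul_logNorm_div_localDegree_algebraMap`), hence
  `norm_eq_one_of_realising_of_not_mem` and **`norm_eq_norm_tΘ_of_realising`**: EVERY Θ-idele `t` over `K` realising `P_Θ` in Dupuy–Hilado's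
  normalisation (the `hT` binder of v7K) has, at any place `w` of `K` over `v ∈ 𝕍(F_mod)`, the absolute value of the GENUINE idele
  `t_{Θ,i,v}` of any idele data `r` of `D` (abc-iut-S2 `ThetaData.IdeleData`) in `K_{v̲}`;
  **`iota_smul_normalizedPacket_subset_of_section`** — the slot containment at ANY `K`-tuple `e` over `p` from the content containment of the
  genuine slot union at the section tuple below `e` (`K/F_mod` Galois: `InitialThetaData.isGalois_fieldOfModuli_K`; the isometric
  `K_{v̲_a} ≃ K_{w_a}`: abc-iut-w5-d056 `RescaledCompletion.exists_algEquiv_norm_eq_of_under_eq`).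
The sequel `Cor312ThetaSideContentBoundK` (this seat) turns this into the `hslot` binder of p438921 VERBATIM for abc-iut-c312-3's exact
content family read below the tuples, and into p438921 with `hslot` DISCHARGED; what then remains for the line-of-record binder
(abc-iut-s2-p6's `Cor312ThetaSideClosedK`) is abc-iut-w5-d056's Galois descent of the right-hand side to the section
(`sum_weightPr_mul_contentHull_eq_placeSection`) and abc-iut-c312-3's `negLogThetaNonarch_eq_of_content` with `A := archLogTheta l`.

[cite: Mochizuki2012, IUTchI Def. 3.1 (e) p. 62, Rmk. 3.1.5 p. 65, Ex. 3.2 (iv) p. 71] [cite: Mochizuki2012, IUTchIII Cor. 3.12 p. 173–174]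
[cite: Mochizuki2012, IUTchIV Thm. 1.10 Step (v) p. 27–28] [cite: DupuyHilado2025, §3.3, §3.4, §3.6, §4.7, §4.12]
[cite: CasselsFrohlichANT1967, Ch. VII §1.1, Prop. 1.2 (ii)] [cite: NeukirchANT1999, Ch. I §8 Prop. (8.2)]
[claim: Mochizuki2012, status: disputed] for every quoted construction. HONEST FRAMING: classical bookkeeping about OUR typed packets and
ideles (Galois theory of completions, valuations in towers); nothing here asserts or denies Cor. 3.12 for any initial Θ-data or takes a side
on any author; typed ≠ proved; instantiated ≠ endorsed.
-/

noncomputable section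

open Set Function NumberField IsDedekindDomain
open scoped Pointwise

/-! ## §1. Generic packet algebra: slot translates under a factorwise isometric isomorphism -/

namespace Summit.ABC.IUTFork.Cor312Vol

open Literature.IUT.LogVolume

section Generic

variable (p : ℕ) [hp : Fact p.Prime] {I : Type} [Fintype I] [DecidableEq I]
  (k : I → Type) [∀ i, NontriviallyNormedField (k i)] [∀ i, NormedAlgebra ℚ_[p] (k i)]
  [∀ i, IsUltrametricDist (k i)] [∀ i, ProperSpace (k i)]
  (k' : I → Type) [∀ i, NontriviallyNormedField (k' i)] [∀ i, NormedAlgebra ℚ_[p] (k' i)]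
  [∀ i, IsUltrametricDist (k' i)] [∀ i, ProperSpace (k' i)]
  (φ : ∀ i, k i ≃ₐ[ℚ_[p]] k' i)

omit [Fintype I] [∀ i, IsUltrametricDist (k i)] [∀ i, ProperSpace (k i)] [∀ i, IsUltrametricDist (k' i)]
  [∀ i, ProperSpace (k' i)] in
/-- `(⊗_b φ_b)(ι_a(u)) = ι_a(φ_a(u))`: the factorwise isomorphism carries the slot embedding of factor `a` to the slot embedding of
factor `a` ([IUTchIII] Prop. 3.2 (i) «functoriality of ⊗»; Mathlib `Pi.apply_mulSingle`). [cite: DupuyHilado2025, §4.7] -/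
theorem factorAlgEquiv_iota (a : I) (u : k a) :
    factorAlgEquiv p k k' φ (iota p k a u) = iota p k' a (φ a u) := by
  rw [iota_eq_purePacket, iota_eq_purePacket, factorAlgEquiv_purePacket]
  congr 1
  funext j
  exact Pi.apply_mulSingle (fun i (x : k i) => φ i x) (fun i => map_one (φ i)) a u j

/-- `(⊗φ)(ι_a(u)·(R_I)^∼) = ι_a(φ_a u)·(R'_I)^∼` (a ring isomorphism; `(⊗φ)((R_I)^∼) = (R'_I)^∼`, abc-iut-w5-d056
`image_normalizedPacket_factor`). [cite: DupuyHilado2025, §4.7, §4.12] -/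
theorem image_factorAlgEquiv_iota_smul_normalizedPacket [Nonempty I] (a : I) (u : k a) :
    factorAlgEquiv p k k' φ '' (iota p k a u • (normalizedPacket p k : Set (PacketAlgebra p k))) =
      iota p k' a (φ a u) • (normalizedPacket p k' : Set (PacketAlgebra p k')) := by
  rw [Set.image_smul_distrib, factorAlgEquiv_iota, image_normalizedPacket_factor]

omit [Fintype I] [DecidableEq I] in
/-- `(⊗φ)(p^m·log_p(R_I^×)) = p^m·log_p(R'_I^×)` for ISOMETRIC `φ` (abc-iut-w5-d056 `image_const_smul_factor`, `image_logPacket_factor`).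
[cite: Mochizuki2012, IUTchIV Prop. 1.2 p. 10] [cite: DupuyHilado2025, §4.7] -/
theorem image_factorAlgEquiv_zpow_smul_logPacket (hφ : ∀ i (x : k i), ‖φ i x‖ = ‖x‖) (m : ℤ) :
    factorAlgEquiv p k k' φ '' (((p : ℚ_[p]) ^ m) • (logPacket p k : Set (PacketAlgebra p k))) =
      ((p : ℚ_[p]) ^ m) • (logPacket p k' : Set (PacketAlgebra p k')) := by
  rw [image_const_smul_factor, image_logPacket_factor p k k' φ hφ]

omit [Fintype I] [∀ i, IsUltrametricDist (k i)] [∀ i, ProperSpace (k i)] in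
/-- **Same slot, same absolute value ⇒ same translate of `(R_I)^∼`**: `‖u'‖ = ‖u‖ ≠ 0 ⇒ ι_a(u')·(R_I)^∼ = ι_a(u)·(R_I)^∼` (`u' = u·(u'/u)`
with `‖u'/u‖ = 1`, and a slot UNIT does not move `(R_I)^∼`: abc-iut-S8 `iota_smul_normalizedPacket_eq_of_norm_eq_one`). The sharp Θ-region
reads the Θ-idele only through its absolute value. [cite: Mochizuki2012, IUTchIV Thm. 1.10 Step (v) p. 27–28] [cite: DupuyHilado2025, §3.9] -/
theorem iota_smul_normalizedPacket_eq_of_norm_eq_sameSlot (a : I) {u u' : k a} (hu : u ≠ 0)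
    (h : ‖u'‖ = ‖u‖) :
    iota p k a u' • (normalizedPacket p k : Set (PacketAlgebra p k)) =
      iota p k a u • (normalizedPacket p k : Set (PacketAlgebra p k)) := by
  have hunit : ‖u' / u‖ = 1 := by rw [norm_div, h, div_self (norm_ne_zero_iff.mpr hu)]
  have hu' : u' = u * (u' / u) := by field_simp
  conv_lhs => rw [hu', map_mul, mul_smul]
  rw [iota_smul_normalizedPacket_eq_of_norm_eq_one p k a hunit]

/-- **SLOT TRANSPORT along a factorwise isometric isomorphism.** If the slot union `⋃_a ι_a(x_a)·(R_I)^∼` of a family of NONZERO slot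
scalars `x` lies in `p^m·log_p(R_I^×)`, then for every slot `a` and every `y ∈ k'_a` with `‖y‖ = ‖x_a‖`, `ι_a(y)·(R'_I)^∼ ⊆ p^m·log_p(R'_I^×)`
in the packet `⊗_b k'_b` (apply `⊗φ` to the `a`-th member, then replace `φ_a(x_a)` by `y`, of the same absolute value).
[cite: Mochizuki2012, IUTchIII Prop. 3.9 (ii) p. 116] [cite: DupuyHilado2025, §4.7, §4.12] -/
theorem iota_smul_normalizedPacket_subset_of_factorIso [Nonempty I] (hφ : ∀ i (x : k i), ‖φ i x‖ = ‖x‖)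
    (x : ∀ a, k a) (hx : ∀ a, x a ≠ 0) {m : ℤ}
    (hm : (⋃ a, iota p k a (x a) • (normalizedPacket p k : Set (PacketAlgebra p k))) ⊆
      ((p : ℚ_[p]) ^ m) • (logPacket p k : Set (PacketAlgebra p k)))
    (a : I) {y : k' a} (hy : ‖y‖ = ‖x a‖) :
    iota p k' a y • (normalizedPacket p k' : Set (PacketAlgebra p k')) ⊆
      ((p : ℚ_[p]) ^ m) • (logPacket p k' : Set (PacketAlgebra p k')) := by
  have h1 : iota p k a (x a) • (normalizedPacket p k : Set (PacketAlgebra p k)) ⊆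
      ((p : ℚ_[p]) ^ m) • (logPacket p k : Set (PacketAlgebra p k)) :=
    (Set.subset_iUnion (fun a => iota p k a (x a) • (normalizedPacket p k : Set (PacketAlgebra p k))) a).trans hm
  have h2 := Set.image_mono (f := ⇑(factorAlgEquiv p k k' φ)) h1
  rw [image_factorAlgEquiv_iota_smul_normalizedPacket, image_factorAlgEquiv_zpow_smul_logPacket p k k' φ hφ] at h2
  have hne : φ a (x a) ≠ 0 := (map_ne_zero (φ a)).mpr (hx a)
  rwa [iota_smul_normalizedPacket_eq_of_norm_eq_sameSlot p k' a hne (by rw [hy, hφ])]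

end Generic

end Summit.ABC.IUTFork.Cor312Vol

/-! ## §2. The `K`-level pilot datum: norms of realising Θ-ideles, and the slot transport from the section -/

namespace Summit.ABC.IUTFork.Cor312Prov

open Cor312 Cor312Vol Literature.IUT.LogThetaLattice Literature.IUT.LogVolume
  Literature.IUT.HodgeTheaters Literature.IUT.LogVolume.ThetaData Literature.NumberTheory.NumberFields
open Thm311.Real hiding finBelow

variable {F K Fbar : Type} [Field F] [NumberField F] [Field K] [NumberField K] [Algebra F K] [Field Fbar]
  [Algebra F Fbar] [Algebra K Fbar] {E : WeierstrassCurve F} [E.IsElliptic] {l : ℕ} {Pb : BadPlacePredicates K}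
  (D : InitialThetaData F K Fbar E l Pb)

/-- A place `w` of `K` is a bad place of the `K`-level pilot datum iff the place of `F_mod` under it lies in `V^bad_mod` (= the bad set of
abc-iut-S2's `pilotData D`): `S_K` = the primes over `𝕍(F)^bad` (abc-iut-C-cert-3 `mem_pilotDataOfK_S_iff`) and `𝕍(F)^bad` = the places over
`V^bad_mod` (abc-iut-S2 `mk_mem_VFbad_iff`). [cite: Mochizuki2012, IUTchI Def. 3.1 (b) p. 61–62] -/
theorem mem_S_pilotDataOfK_iff_finBelow_mem (w : HeightOneSpectrum (𝓞 K)) :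
    w ∈ (pilotDataOfK D K).S ↔ finBelow (fieldOfModuli E) K w ∈ (pilotData D).S := by
  rw [mem_pilotDataOfK_S_iff, mk_mem_VFbad_iff, pilotData_S, ← finBelow_eq_under (fieldOfModuli E) F,
    finBelow_finBelow (fieldOfModuli E) F K]

/-- The `j`-invariant of the `K`-level pilot datum is `j_E ∈ F_mod` viewed in `K` (tower `F_mod ⊆ F ⊆ K`).
[cite: Mochizuki2012, IUTchI Def. 3.1 (b) p. 61] -/
theorem pilotDataOfK_jE_eq_algebraMap_jMod :
    (pilotDataOfK D K).jE = algebraMap (fieldOfModuli E) K (jMod E) := by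
  show algebraMap F K E.j = _
  rw [IsScalarTower.algebraMap_apply (fieldOfModuli E) F K (jMod E)]
  rfl

/-- **The normalised local Θ-pilot height does not see the field**: for a place `w` of `K` over the place `v` of `F_mod`,
`P_{Θ,K}(i,w)·log N(w)/n_w = P_{Θ,mod}(i,v)·log N(v)/n_v`, where `P_{Θ,K}` is the Θ-pilot of the `K`-level datum `pilotDataOfK D K`
(coefficient `(i+1)²·ord_w(q)/(2l)`, `ord_w(q) = −ord_w(j_E)`) and `P_{Θ,mod}` that of abc-iut-S2's `pilotData D` over `F_mod` (`ord_v(q_v) =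
−ord_v(j_E)`): `ord_w(j_E)·log N(w)/n_w = ord_v(j_E)·log N(v)/n_v` (abc-iut-s2-p5 `ord_mul_logNorm_div_localDegree_algebraMap`: `ord_w =
e(w|v)·ord_v`, `log N(w)/n_w = log p/e_w`, `e_w = e(w|v)·e_v`). Off the bad sets both sides vanish.
[cite: DupuyHilado2025, §3.3, §3.4] [cite: NeukirchANT1999, Ch. I §8 Prop. (8.2)] -/
theorem thetaPilot_pilotDataOfK_mul_logNorm_div_localDegree (i : Fin (pilotData D).lstar)
    (w : HeightOneSpectrum (𝓞 K)) :
    (pilotDataOfK D K).thetaPilot i w * logNorm K w / (localDegree K w : ℝ) =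
      (pilotData D).thetaPilot i (finBelow (fieldOfModuli E) K w) *
          logNorm (fieldOfModuli E) (finBelow (fieldOfModuli E) K w) /
        (localDegree (fieldOfModuli E) (finBelow (fieldOfModuli E) K w) : ℝ) := by
  by_cases hw : w ∈ (pilotDataOfK D K).S
  · have hv : finBelow (fieldOfModuli E) K w ∈ (pilotData D).S := (mem_S_pilotDataOfK_iff_finBelow_mem D w).mp hw
    have hK : ((pilotDataOfK D K).ordq w : ℝ) = -(ord K w (algebraMap (fieldOfModuli E) K (jMod E)) : ℝ) := by
      rw [PilotData.ordq, pilotDataOfK_jE_eq_algebraMap_jMod]; push_cast; ring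
    have hM : ((pilotData D).ordq (finBelow (fieldOfModuli E) K w) : ℝ) =
        -(ord (fieldOfModuli E) (finBelow (fieldOfModuli E) K w) (jMod E) : ℝ) := by
      rw [PilotData.ordq, pilotData_jE]; push_cast; ring
    have key := ord_mul_logNorm_div_localDegree_algebraMap (F₀ := fieldOfModuli E) w (jMod E)
    rw [(pilotDataOfK D K).thetaPilot_apply_of_mem i hw, (pilotData D).thetaPilot_apply_of_mem i hv, hK, hM,
      pilotDataOfK_l, pilotData_l]
    calc ((((i : ℕ) : ℝ) + 1) ^ 2) * -(ord K w (algebraMap (fieldOfModuli E) K (jMod E)) : ℝ) / (2 * (l : ℝ)) *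
          logNorm K w / (localDegree K w : ℝ)
        = -(((((i : ℕ) : ℝ) + 1) ^ 2) / (2 * (l : ℝ))) *
            ((ord K w (algebraMap (fieldOfModuli E) K (jMod E)) : ℝ) * logNorm K w / (localDegree K w : ℝ)) := by
          ring
      _ = -(((((i : ℕ) : ℝ) + 1) ^ 2) / (2 * (l : ℝ))) *
            ((ord (fieldOfModuli E) (finBelow (fieldOfModuli E) K w) (jMod E) : ℝ) *
              logNorm (fieldOfModuli E) (finBelow (fieldOfModuli E) K w) /
                (localDegree (fieldOfModuli E) (finBelow (fieldOfModuli E) K w) : ℝ)) := by rw [key]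
      _ = _ := by ring
  · have hv : finBelow (fieldOfModuli E) K w ∉ (pilotData D).S :=
      fun h => hw ((mem_S_pilotDataOfK_iff_finBelow_mem D w).mpr h)
    rw [(pilotDataOfK D K).thetaPilot_apply_of_not_mem i hw, (pilotData D).thetaPilot_apply_of_not_mem i hv]
    simp

section Realising

variable
  (t : ∀ (pp : Nat.Primes) (_ : Fin (pilotDataOfK D K).lstar) (x : (thetaIndex (pilotDataOfK D K)).Fibre (.inr pp)),
    haveI : Fact (pp : ℕ).Prime := ⟨pp.2⟩; kOf (pilotDataOfK D K) pp.1 x)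

/-- **A realising Θ-idele is a unit off `S`** (the `ht1` binder of abc-iut-c312-7's `settingPrVolSharp` FOLLOWS from the realising binder
`hT` of v7K: `P_Θ = 0` off `S`, so `log ‖t‖ = 0` with `t ≠ 0`; the computation of abc-iut-C-cert-3's `exists_realising_thetaIdeles_of_twoMulLDvdOrdq`,
stated for a GIVEN `t`). [cite: DupuyHilado2025, §3.3, §3.4] -/
theorem norm_eq_one_of_realising_of_not_mem (ht0 : ∀ pp i x, t pp i x ≠ 0)
    (hT : ∀ (pp : Nat.Primes) (i : Fin (pilotDataOfK D K).lstar) (x : (thetaIndex (pilotDataOfK D K)).Fibre (.inr pp)),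
      haveI : Fact (pp : ℕ).Prime := ⟨pp.2⟩
      Real.log ‖t pp i x‖ = -((pilotDataOfK D K).thetaPilot i (placeOf (pilotDataOfK D K) pp.1 x)) *
        logNorm K (placeOf (pilotDataOfK D K) pp.1 x) / localDegree K (placeOf (pilotDataOfK D K) pp.1 x))
    (pp : Nat.Primes) (i : Fin (pilotDataOfK D K).lstar) (x : (thetaIndex (pilotDataOfK D K)).Fibre (.inr pp))
    (hx : haveI : Fact (pp : ℕ).Prime := ⟨pp.2⟩; placeOf (pilotDataOfK D K) pp.1 x ∉ (pilotDataOfK D K).S) :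
    ‖t pp i x‖ = 1 := by
  haveI : Fact (pp : ℕ).Prime := ⟨pp.2⟩
  have h1 := hT pp i x
  rw [(pilotDataOfK D K).thetaPilot_apply_of_not_mem i hx, neg_zero, zero_mul, zero_div] at h1
  exact Real.eq_one_of_pos_of_log_eq_zero (norm_pos_iff.mpr (ht0 pp i x)) h1

/-- **Every realising Θ-idele over `K` has the absolute value of the GENUINE Θ-idele below it**: for idele data `r` of `D` (abc-iut-S2
`ThetaData.IdeleData`: units `t_{Θ,i,v} ∈ K_{v̲}^×` with `ord_v(t_{Θ,i,v}) = P_{Θ,mod}(i,v)`) and a Θ-idele `t` over `K` realising `P_{Θ,K}` in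
Dupuy–Hilado's normalisation (the `hT` binder of v7K: `log ‖t_{i,w}‖ = −P_{Θ,K}(i,w)·log N(w)/n_w`), at every place `w` of `K` over `p` lying over
`v ∈ 𝕍(F_mod)_p`: `‖t_{i,w}‖ = ‖t_{Θ,i,v}‖` (both logarithms equal `−P_{Θ,mod}(i,v)·log N(v)/n_v`: `thetaPilot_pilotDataOfK_mul_logNorm_div_localDegree`
and abc-iut-S2's (3.4) `LocalFields.log_norm_eq_neg_ordv`). [cite: DupuyHilado2025, §3.4, §3.9] [cite: Mochizuki2012, IUTchI Ex. 3.2 (iv) p. 71] -/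
theorem norm_eq_norm_tΘ_of_realising (r : IdeleData D) (ht0 : ∀ pp i x, t pp i x ≠ 0)
    (hT : ∀ (pp : Nat.Primes) (i : Fin (pilotDataOfK D K).lstar) (x : (thetaIndex (pilotDataOfK D K)).Fibre (.inr pp)),
      haveI : Fact (pp : ℕ).Prime := ⟨pp.2⟩
      Real.log ‖t pp i x‖ = -((pilotDataOfK D K).thetaPilot i (placeOf (pilotDataOfK D K) pp.1 x)) *
        logNorm K (placeOf (pilotDataOfK D K) pp.1 x) / localDegree K (placeOf (pilotDataOfK D K) pp.1 x))
    (pp : Nat.Primes) (i : Fin (pilotDataOfK D K).lstar) (x : (thetaIndex (pilotDataOfK D K)).Fibre (.inr pp)) :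
    haveI : Fact (pp : ℕ).Prime := ⟨pp.2⟩
    ‖t pp i x‖ =
      ‖((r.tΘ pp.1 pp.2 i ⟨finBelow (fieldOfModuli E) K (placeOf (pilotDataOfK D K) pp.1 x),
            finBelow_mem_placesOver (fieldOfModuli E) K (placeOf_mem (pilotDataOfK D K) pp.1 x)⟩ :
          (((placeSection D).localFieldFamily pp.1 pp.2).k
            ⟨finBelow (fieldOfModuli E) K (placeOf (pilotDataOfK D K) pp.1 x),
              finBelow_mem_placesOver (fieldOfModuli E) K (placeOf_mem (pilotDataOfK D K) pp.1 x)⟩)ˣ) :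
        ((placeSection D).localFieldFamily pp.1 pp.2).k
          ⟨finBelow (fieldOfModuli E) K (placeOf (pilotDataOfK D K) pp.1 x),
            finBelow_mem_placesOver (fieldOfModuli E) K (placeOf_mem (pilotDataOfK D K) pp.1 x)⟩)‖ := by
  haveI : Fact (pp : ℕ).Prime := ⟨pp.2⟩
  set v : placesOver (fieldOfModuli E) pp.1 := ⟨finBelow (fieldOfModuli E) K (placeOf (pilotDataOfK D K) pp.1 x),
    finBelow_mem_placesOver (fieldOfModuli E) K (placeOf_mem (pilotDataOfK D K) pp.1 x)⟩ with hvdef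
  have h1 := hT pp i x
  have h2 := LocalFields.log_norm_eq_neg_ordv ((placeSection D).localFieldFamily pp.1 pp.2) (r.tΘ pp.1 pp.2 i v)
  rw [r.tΘ_ord pp.1 pp.2 i v] at h2
  have h3 := thetaPilot_pilotDataOfK_mul_logNorm_div_localDegree D i (placeOf (pilotDataOfK D K) pp.1 x)
  have hlog : Real.log ‖t pp i x‖ =
      Real.log ‖((r.tΘ pp.1 pp.2 i v : _) : ((placeSection D).localFieldFamily pp.1 pp.2).k v)‖ := by
    rw [h1, h2, neg_mul, neg_div, neg_mul, neg_div, h3]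
  have hpos1 : 0 < ‖t pp i x‖ := norm_pos_iff.mpr (ht0 pp i x)
  have hpos2 : 0 < ‖((r.tΘ pp.1 pp.2 i v : _) : ((placeSection D).localFieldFamily pp.1 pp.2).k v)‖ :=
    norm_pos_iff.mpr (Units.ne_zero _)
  exact Real.log_injOn_pos (Set.mem_Ioi.mpr hpos1) (Set.mem_Ioi.mpr hpos2) hlog

/-- **SLOT TRANSPORT FROM THE SECTION (step (a) of the `K`-level hΘ descent).** Let `D` be initial Θ-data, `r` idele data of `D`
(genuine input `volumeInputOf D r` of abc-iut-S2: completions `K_{v̲}` at the section `V̲`, ideles `t_Θ`), `t` ANY Θ-idele over `K` realising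
`P_{Θ,K}` (v7K's `ht0`, `hT`), `e : S^±_{i+2} → 𝕍(K)_p` a tuple of places of `K` (fibre elements of abc-iut-c312-5's `thetaIndex (pilotDataOfK D K)`)
and `v⃗` the tuple of places of `F_mod` below it. IF the genuine slot union at the SECTION tuple satisfies
`⋃_b ι_b(t_{Θ,i,v_b})·(R_{v̲⃗})^∼ ⊆ p^m·log_p(R_{v̲⃗}^×)` (e.g. `m` = abc-iut-c312-3's content `exists_contentFamily` at `(p, i, v⃗)`), THEN at `e`,
for every slot `a`: `ι_a(t_{i,e_a})·(R_e)^∼ ⊆ p^m·log_p(R_e^×)` in abc-iut-c312-5's summand `X_e = ⊗_a K_{e_a}` (`(presAt X hlog p).X e`) — the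
`hslot` binder of abc-iut-s2-p7's `negLogTheta_settingPrVolSharp_le_sum_content_hull` at `(p, i, e, a)`. PROOF: `K/F_mod` is Galois
([IUTchI] Rmk. 3.1.5; `InitialThetaData.isGalois_fieldOfModuli_K`), so each `K_{v̲_a}` is isometrically `ℚ_p`-isomorphic to `K_{e_a}`
(abc-iut-w5-d056 `RescaledCompletion.exists_algEquiv_norm_eq_of_under_eq`); transport along `⊗_a φ_a` (§1) and use `‖t_{i,e_a}‖ = ‖t_{Θ,i,v_a}‖`
(`norm_eq_norm_tΘ_of_realising`). [cite: Mochizuki2012, IUTchI Rmk. 3.1.5 p. 65] [cite: Mochizuki2012, IUTchIV Thm. 1.10 Step (v) p. 27–28]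
[cite: CasselsFrohlichANT1967, Ch. VII Prop. 1.2 (ii)] [cite: DupuyHilado2025, §4.12] -/
theorem iota_smul_normalizedPacket_subset_of_section {logv : PadicLogs K} (hlog : LogvAnalytic logv)
    (r : IdeleData D) (ht0 : ∀ pp i x, t pp i x ≠ 0)
    (hT : ∀ (pp : Nat.Primes) (i : Fin (pilotDataOfK D K).lstar) (x : (thetaIndex (pilotDataOfK D K)).Fibre (.inr pp)),
      haveI : Fact (pp : ℕ).Prime := ⟨pp.2⟩
      Real.log ‖t pp i x‖ = -((pilotDataOfK D K).thetaPilot i (placeOf (pilotDataOfK D K) pp.1 x)) *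
        logNorm K (placeOf (pilotDataOfK D K) pp.1 x) / localDegree K (placeOf (pilotDataOfK D K) pp.1 x))
    (pp : Nat.Primes) (i : Fin (thetaIndex (pilotDataOfK D K)).lstar)
    (e : (thetaIndex (pilotDataOfK D K)).Caps (Setting.labelSucc i) → (thetaIndex (pilotDataOfK D K)).Fibre (.inr pp))
    {m : ℤ}
    (hm : haveI : Fact (pp : ℕ).Prime := ⟨pp.2⟩
      (⋃ a : Fin ((i : ℕ) + 1 + 1),
          iota pp.1 (fun b => ((volumeInputOf D r).σ.localFieldFamily pp.1 pp.2).k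
              ⟨finBelow (fieldOfModuli E) K (placeOf (pilotDataOfK D K) pp.1 (e b)),
                finBelow_mem_placesOver (fieldOfModuli E) K (placeOf_mem (pilotDataOfK D K) pp.1 (e b))⟩) a
            ((volumeInputOf D r).tΘ pp.1 pp.2 i
                ⟨finBelow (fieldOfModuli E) K (placeOf (pilotDataOfK D K) pp.1 (e a)),
                  finBelow_mem_placesOver (fieldOfModuli E) K (placeOf_mem (pilotDataOfK D K) pp.1 (e a))⟩ :
              ((volumeInputOf D r).σ.localFieldFamily pp.1 pp.2).k
                ⟨finBelow (fieldOfModuli E) K (placeOf (pilotDataOfK D K) pp.1 (e a)),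
                  finBelow_mem_placesOver (fieldOfModuli E) K (placeOf_mem (pilotDataOfK D K) pp.1 (e a))⟩) •
          (normalizedPacket pp.1 (fun b => ((volumeInputOf D r).σ.localFieldFamily pp.1 pp.2).k
              ⟨finBelow (fieldOfModuli E) K (placeOf (pilotDataOfK D K) pp.1 (e b)),
                finBelow_mem_placesOver (fieldOfModuli E) K (placeOf_mem (pilotDataOfK D K) pp.1 (e b))⟩) :
            Set (PacketAlgebra pp.1 (fun b => ((volumeInputOf D r).σ.localFieldFamily pp.1 pp.2).k
              ⟨finBelow (fieldOfModuli E) K (placeOf (pilotDataOfK D K) pp.1 (e b)),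
                finBelow_mem_placesOver (fieldOfModuli E) K (placeOf_mem (pilotDataOfK D K) pp.1 (e b))⟩)))) ⊆
        (((pp : ℕ) : ℚ_[pp]) ^ m) •
          (logPacket pp.1 (fun b => ((volumeInputOf D r).σ.localFieldFamily pp.1 pp.2).k
              ⟨finBelow (fieldOfModuli E) K (placeOf (pilotDataOfK D K) pp.1 (e b)),
                finBelow_mem_placesOver (fieldOfModuli E) K (placeOf_mem (pilotDataOfK D K) pp.1 (e b))⟩) :
            Set (PacketAlgebra pp.1 (fun b => ((volumeInputOf D r).σ.localFieldFamily pp.1 pp.2).k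
              ⟨finBelow (fieldOfModuli E) K (placeOf (pilotDataOfK D K) pp.1 (e b)),
                finBelow_mem_placesOver (fieldOfModuli E) K (placeOf_mem (pilotDataOfK D K) pp.1 (e b))⟩))))
    (a : (thetaIndex (pilotDataOfK D K)).Caps (Setting.labelSucc i)) :
    haveI : Fact (pp : ℕ).Prime := ⟨pp.2⟩
    iota pp.1 ((presAt (pilotDataOfK D K) hlog pp).kk e) a (t pp i (e a)) •
        (normalizedPacket pp.1 ((presAt (pilotDataOfK D K) hlog pp).kk e) :
          Set ((presAt (pilotDataOfK D K) hlog pp).X e)) ⊆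
      (((pp : ℕ) : ℚ_[pp]) ^ m) •
        (logPacket pp.1 ((presAt (pilotDataOfK D K) hlog pp).kk e) : Set ((presAt (pilotDataOfK D K) hlog pp).X e)) := by
  haveI : Fact (pp : ℕ).Prime := ⟨pp.2⟩
  haveI : IsGalois (fieldOfModuli E) K := D.isGalois_fieldOfModuli_K
  -- the section tuple below `e`
  let v : (thetaIndex (pilotDataOfK D K)).Caps (Setting.labelSucc i) → placesOver (fieldOfModuli E) pp.1 := fun b =>
    ⟨finBelow (fieldOfModuli E) K (placeOf (pilotDataOfK D K) pp.1 (e b)),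
      finBelow_mem_placesOver (fieldOfModuli E) K (placeOf_mem (pilotDataOfK D K) pp.1 (e b))⟩
  have hunder : ∀ b, ((placeSection D).lift (v b).1).under (𝓞 (fieldOfModuli E)) =
      (placeOf (pilotDataOfK D K) pp.1 (e b)).under (𝓞 (fieldOfModuli E)) := fun b => by
    rw [(placeSection D).under_lift, ← finBelow_eq_under (fieldOfModuli E) K]
  -- `K/F_mod` Galois: isometric `K_{v̲_b} ≃ₐ[ℚ_p] K_{e_b}` for every slot
  choose φ hφ using fun b => RescaledCompletion.exists_algEquiv_norm_eq_of_under_eq (F₀ := fieldOfModuli E) (p := pp.1)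
    ((placeSection D).lift (v b).1) (placeOf (pilotDataOfK D K) pp.1 (e b)) ((placeSection D).natCast_mem_lift (v b))
    (natCast_mem_placeOf (pilotDataOfK D K) pp.1 (e b)) (hunder b)
  exact Cor312Vol.iota_smul_normalizedPacket_subset_of_factorIso pp.1
    (fun b => ((volumeInputOf D r).σ.localFieldFamily pp.1 pp.2).k (v b)) ((presAt (pilotDataOfK D K) hlog pp).kk e)
    φ hφ (fun b => ((volumeInputOf D r).tΘ pp.1 pp.2 i (v b) : ((volumeInputOf D r).σ.localFieldFamily pp.1 pp.2).k (v b)))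
    (fun b => Units.ne_zero _) hm a (norm_eq_norm_tΘ_of_realising D t r ht0 hT pp i (e a))

end Realising

end Summit.ABC.IUTFork.Cor312Prov

end
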